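import Mathlib
import Summits.Ventures.PercRepro2.Defs
import Summits.Ventures.PercRepro2.Harris
import Summits.Ventures.PercRepro2.Independence
import Summits.Ventures.PercRepro2.CoinDefs
import Summits.Ventures.PercRepro2.CoinReverse
import Summits.Ventures.PercRepro2.CoinStarDefs
import Summits.Ventures.PercRepro2.CoinLsmCoreDefs
import Summits.Ventures.PercRepro2.CoinLsmCoreU
import Summits.Ventures.PercRepro2.CoinCoreGate
import Summits.Ventures.PercRepro2.CoinOrTailAlg
import Summits.Ventures.PercRepro2.CoinOrTailDefs
import Summits.Ventures.PercRepro2.CoinOrTailLsmDefs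
import Summits.Ventures.PercRepro2.CoinOrTailLsmSums
import Summits.Ventures.PercRepro2.CoinOrTailBlockAlg
import Summits.Ventures.PercRepro2.CoinOrTailBlockSums
import Summits.Ventures.PercRepro2.CoinOrTailMixLsm
import Summits.Ventures.PercRepro2.CoinLsmCoreSure
import Summits.Ventures.PercRepro2.CoinOrTailKDefs
import Summits.Ventures.PercRepro2.CoinOrTailKSums
import Summits.Ventures.PercRepro2.CoinOrTailKAlg
import Summits.Ventures.PercRepro2.CoinOrTailCovCore
import Summits.Ventures.PercRepro2.CoinOrTailKCore
import Summits.Ventures.PercRepro2.CoinK2HeadBlindVals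
import Summits.Ventures.PercRepro2.CoinK2HeadAwareAD
import Summits.Ventures.PercRepro2.CoinTreeCore
import Summits.Ventures.PercRepro2.CoinKSureLayer
import Summits.Ventures.PercRepro2.CoinKSureAD
import Summits.Ventures.PercRepro2.CoinKSureFibers
import Summits.Ventures.PercRepro2.CoinKSureGate

/-!
# Row 2′DARC at an OR-tail with ANY SET OF SURE ENTRIES — ANY head, ANY markers
(blind cell PercRepro2, night-2 g14; proofs/NIGHT2-DARC.md §49)

`orTailKSure_functional_nonneg`: the cleared functional of an OR-tail whose entry set `ent` is
ARBITRARY (any number of entries, any traces, none covered by the markers), all tail coins sure,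
the cluster law `ν` log-supermodular and the head `A` nonnegative, decreasing, log-supermodular,
is nonnegative — by the abstract theorem `gate_functional_nonneg` (the clean state lemma) with
the weights `ν · rValK` (the `R`-law) and `ν · gValK` (the gate), fed by `rValK_mul_le_all`,
`gValK_mul_le_all`, `rValK_mul_gValK_le_of_entry` and `gValK_eq_rValK_of_no_entry`.

`darc_of_orTailKSure`: row 2′DARC at `a → w` for ANY two markers of the core, every head, every
probability vector; `darc_of_orTailTreeKSure` the out-tree corollary.  The theorems
`darc_of_orTailK2` (two entries) and `darc_of_orTailLsmKOne` / `darc_of_orTailLsmK` with sure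
coins are special cases. -/

namespace Summit.Ventures.PercRepro2.Coin

open Classical

section KSureFunctional

variable {V : Type*} {E : Type*} [Fintype V] [DecidableEq V] {R : Type*} [Field R] [LinearOrder R]
  [IsStrictOrderedRing R]

/-- **THE OR-TAIL FUNCTIONAL WITH ANY SET OF SURE ENTRIES IS NONNEGATIVE**: `ent` arbitrary with
sure coins, `ν` log-supermodular on `U`, the head `A` nonnegative, decreasing and
log-supermodular; ANY two markers; no further hypothesis. -/
theorem orTailKSure_functional_nonneg (U : Finset V) (ν A : Finset V → R) (pr : E → R)
    (ent : Finset V) (c : V → E) (m₁ m₂ a w : V)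
    (hp0 : ∀ e, 0 ≤ pr e) (hp1 : ∀ e, pr e ≤ 1) (hsure : ∀ r ∈ ent, pr (c r) = 1)
    (hν0 : ∀ W, 0 ≤ ν W) (hν : ∀ s ⊆ U, ∀ t ⊆ U, ν s * ν t ≤ ν (s ∩ t) * ν (s ∪ t))
    (hA0 : ∀ W, 0 ≤ A W) (hA : ∀ s t : Finset V, A s * A t ≤ A (s ∩ t) * A (s ∪ t))
    (hmono : ∀ s t : Finset V, s ⊆ t → A t ≤ A s) :
    0 ≤ (∑ W ∈ U.powerset, ν W * rValK A pr ent c a W) ^ 2 *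
          (∑ W ∈ U.powerset, ν W * gValK A pr ent c a w W *
            ((if m₁ ∈ W then (1 : R) else 0) * (if m₂ ∈ W then (1 : R) else 0)))
        - (∑ W ∈ U.powerset, ν W * rValK A pr ent c a W) *
          (∑ W ∈ U.powerset, ν W * rValK A pr ent c a W * (if m₁ ∈ W then (1 : R) else 0)) *
          (∑ W ∈ U.powerset, ν W * gValK A pr ent c a w W * (if m₂ ∈ W then (1 : R) else 0))
        - (∑ W ∈ U.powerset, ν W * rValK A pr ent c a W) *
          (∑ W ∈ U.powerset, ν W * rValK A pr ent c a W * (if m₂ ∈ W then (1 : R) else 0)) *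
          (∑ W ∈ U.powerset, ν W * gValK A pr ent c a w W * (if m₁ ∈ W then (1 : R) else 0))
        + (∑ W ∈ U.powerset, ν W * rValK A pr ent c a W * (if m₁ ∈ W then (1 : R) else 0)) *
          (∑ W ∈ U.powerset, ν W * rValK A pr ent c a W * (if m₂ ∈ W then (1 : R) else 0)) *
          (∑ W ∈ U.powerset, ν W * gValK A pr ent c a w W) := by
  have hr0 : ∀ W, 0 ≤ rValK A pr ent c a W := fun W => rValK_nonneg hp0 hp1 hA0 ent c a W
  have hg0 : ∀ W, 0 ≤ gValK A pr ent c a w W := fun W => gValK_nonneg hp0 hp1 hA0 ent c a w W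
  set G : Finset V → R := fun W => ν W * rValK A pr ent c a W with hGdef
  set G' : Finset V → R := fun W => ν W * gValK A pr ent c a w W with hG'def
  have hG0 : ∀ W, 0 ≤ G W := fun W => mul_nonneg (hν0 W) (hr0 W)
  have hG'0 : ∀ W, 0 ≤ G' W := fun W => mul_nonneg (hν0 W) (hg0 W)
  have wLL : ∀ s ⊆ U, ∀ t ⊆ U, G s * G t ≤ G (s ∩ t) * G (s ∪ t) := by
    intro s hs t ht
    simp only [hGdef]
    calc ν s * rValK A pr ent c a s * (ν t * rValK A pr ent c a t)
        = (ν s * ν t) * (rValK A pr ent c a s * rValK A pr ent c a t) := by ring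
      _ ≤ (ν (s ∩ t) * ν (s ∪ t)) *
            (rValK A pr ent c a (s ∩ t) * rValK A pr ent c a (s ∪ t)) :=
          mul_le_mul (hν s hs t ht) (rValK_mul_le_all A pr ent c a hp0 hp1 hA0 hA hmono s t)
            (mul_nonneg (hr0 _) (hr0 _)) (mul_nonneg (hν0 _) (hν0 _))
      _ = _ := by ring
  have wMM : ∀ s ⊆ U, ∀ t ⊆ U, G' s * G' t ≤ G' (s ∩ t) * G' (s ∪ t) := by
    intro s hs t ht
    simp only [hG'def]
    calc ν s * gValK A pr ent c a w s * (ν t * gValK A pr ent c a w t)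
        = (ν s * ν t) * (gValK A pr ent c a w s * gValK A pr ent c a w t) := by ring
      _ ≤ (ν (s ∩ t) * ν (s ∪ t)) *
            (gValK A pr ent c a w (s ∩ t) * gValK A pr ent c a w (s ∪ t)) :=
          mul_le_mul (hν s hs t ht) (gValK_mul_le_all A pr ent c a w hp0 hp1 hA0 hA hmono s t)
            (mul_nonneg (hg0 _) (hg0 _)) (mul_nonneg (hν0 _) (hν0 _))
      _ = _ := by ring
  have wLM : ∀ s ⊆ U, ∀ t ⊆ U, (∃ r ∈ ent, r ∈ t) →
      G s * G' t ≤ G (s ∩ t) * G' (s ∪ t) := by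
    intro s hs t ht hte
    simp only [hGdef, hG'def]
    calc ν s * rValK A pr ent c a s * (ν t * gValK A pr ent c a w t)
        = (ν s * ν t) * (rValK A pr ent c a s * gValK A pr ent c a w t) := by ring
      _ ≤ (ν (s ∩ t) * ν (s ∪ t)) *
            (rValK A pr ent c a (s ∩ t) * gValK A pr ent c a w (s ∪ t)) :=
          mul_le_mul (hν s hs t ht)
            (rValK_mul_gValK_le_of_entry A pr c a w hsure hA0 hA hmono hte)
            (mul_nonneg (hr0 _) (hg0 _)) (mul_nonneg (hν0 _) (hν0 _))
      _ = _ := by ring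
  have wML : ∀ s ⊆ U, ∀ t ⊆ U, (∃ r ∈ ent, r ∈ s) →
      G' s * G t ≤ G (s ∩ t) * G' (s ∪ t) := by
    intro s hs t ht hse
    have := wLM t ht s hs hse
    rw [Finset.inter_comm, Finset.union_comm, mul_comm] at this
    exact this
  have hI : ∀ W, W ∩ ent = ∅ → G' W = G W := by
    intro W hW
    have hno : ∀ r ∈ ent, r ∉ W := by
      intro r hr hrW
      have : r ∈ W ∩ ent := Finset.mem_inter.mpr ⟨hrW, hr⟩
      rw [hW] at this
      exact Finset.notMem_empty r this
    simp only [hGdef, hG'def]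
    rw [gValK_eq_rValK_of_no_entry A pr c a w hno]
  have hx0 : ∀ W : Finset V, (0 : R) ≤ (if m₁ ∈ W then (1 : R) else 0) := by
    intro W; split_ifs <;> norm_num
  have hy0 : ∀ W : Finset V, (0 : R) ≤ (if m₂ ∈ W then (1 : R) else 0) := by
    intro W; split_ifs <;> norm_num
  have hxm : ∀ s t : Finset V,
      (if m₁ ∈ s then (1 : R) else 0) ≤ (if m₁ ∈ s ∪ t then (1 : R) else 0) := by
    intro s t
    by_cases h : m₁ ∈ s
    · rw [if_pos h, if_pos (Finset.mem_union_left t h)]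
    · rw [if_neg h]; split_ifs <;> norm_num
  have hym : ∀ s t : Finset V,
      (if m₂ ∈ s then (1 : R) else 0) ≤ (if m₂ ∈ s ∪ t then (1 : R) else 0) := by
    intro s t
    by_cases h : m₂ ∈ s
    · rw [if_pos h, if_pos (Finset.mem_union_left t h)]
    · rw [if_neg h]; split_ifs <;> norm_num
  exact gate_functional_nonneg U ent G G' (fun W => if m₁ ∈ W then (1 : R) else 0)
    (fun W => if m₂ ∈ W then (1 : R) else 0) hG0 hG'0 hx0 hy0 hxm hym wLL wMM wML hI

end KSureFunctional

section KSureMain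

variable {V : Type*} {E : Type*} [Fintype V] [DecidableEq V] [Fintype E] [DecidableEq E]
  {R : Type*} [Field R] [LinearOrder R] [IsStrictOrderedRing R]
  {arcs : E → Finset (V × V)} {s : V} {U : Finset V} {ent : Finset V} {c : V → E} {a w : V}

/-- **THEOREM (row 2′DARC at an OR-tail with ANY set of sure entries — ANY head, ANY markers).**
`OrTailK arcs s U ent c a` with an ARBITRARY entry set `ent` of SURE tail coins (`hsure`),
`SameEnds`, the cluster law of `U` log-supermodular (`hν`), ANY two markers `m₁, m₂ ∈ U`,
`t, w ∉ U ∪ {a, s}` ⟹ `Φ_D({s ↛ t in D + (a → w)}) ≥ 0` for the markers `m₁, m₂` at every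
head (the head sees the whole cluster), every probability vector — no covering, no
head-blindness, no non-degeneracy, any number of entries. -/
theorem darc_of_orTailKSure (pr : E → R) (hp : IsProbVec pr) (hS : SameEnds arcs)
    (h : OrTailK arcs s U ent c a) {m₁ m₂ : V} (hm₁ : m₁ ∈ U) (hm₂ : m₂ ∈ U)
    (hsure : ∀ r ∈ ent, pr (c r) = 1)
    (hν : ∀ W W', W ⊆ U → W' ⊆ U →
      prob pr (coreLevel arcs s U W) * prob pr (coreLevel arcs s U W') ≤
        prob pr (coreLevel arcs s U (W ∩ W')) * prob pr (coreLevel arcs s U (W ∪ W')))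
    {t : V} (htC : t ∉ insert a U) (hts : t ≠ s) (hws : w ≠ s) (hwC : w ∉ insert a U) :
    DARC pr arcs s {t} m₁ m₂ a w := by
  have hC := h.closedInCoreU
  have hm₁a : m₁ ≠ a := fun e => h.a_notin (e ▸ hm₁)
  have hm₂a : m₂ ≠ a := fun e => h.a_notin (e ▸ hm₂)
  have hm₁C : m₁ ∈ insert a U := Finset.mem_insert_of_mem hm₁
  have hm₂C : m₂ ∈ insert a U := Finset.mem_insert_of_mem hm₂
  have haC : a ∈ insert a U := Finset.mem_insert_self _ _
  unfold DARC
  rw [hC.phiC_gate_eq pr hS htC hts hm₁C hm₂C haC hws hwC]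
  have hm1 : ∀ W : Finset V, (fun _ : Finset V => (1 : R)) (insert a W) = (fun _ => (1 : R)) W :=
    fun _ => rfl
  have hmp : ∀ W : Finset V, (fun W : Finset V => if m₁ ∈ W then (1 : R) else 0) (insert a W) =
      (fun W : Finset V => if m₁ ∈ W then (1 : R) else 0) W := by
    intro W; simp only [Finset.mem_insert, hm₁a, false_or]
  have hmq : ∀ W : Finset V, (fun W : Finset V => if m₂ ∈ W then (1 : R) else 0) (insert a W) =
      (fun W : Finset V => if m₂ ∈ W then (1 : R) else 0) W := by
    intro W; simp only [Finset.mem_insert, hm₂a, false_or]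
  have hmpq : ∀ W : Finset V,
      (fun W : Finset V => (if m₁ ∈ W then (1 : R) else 0) * (if m₂ ∈ W then (1 : R) else 0))
        (insert a W) =
      (fun W : Finset V => (if m₁ ∈ W then (1 : R) else 0) * (if m₂ ∈ W then (1 : R) else 0)) W := by
    intro W; simp only [Finset.mem_insert, hm₁a, hm₂a, false_or]
  have eΛ := h.sum_R_eq pr t (fun _ => (1 : R)) hm1
  have eFa := h.sum_R_eq pr t (fun W => if m₁ ∈ W then (1 : R) else 0) hmp
  have eFb := h.sum_R_eq pr t (fun W => if m₂ ∈ W then (1 : R) else 0) hmq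
  have eM := h.sum_G_eq (w := w) pr t (fun _ => (1 : R)) hm1
  have eX := h.sum_G_eq (w := w) pr t (fun W => if m₁ ∈ W then (1 : R) else 0) hmp
  have eY := h.sum_G_eq (w := w) pr t (fun W => if m₂ ∈ W then (1 : R) else 0) hmq
  have eXY := h.sum_G_eq (w := w) pr t
    (fun W => (if m₁ ∈ W then (1 : R) else 0) * (if m₂ ∈ W then (1 : R) else 0)) hmpq
  simp only [mul_one] at eΛ eM
  rw [eΛ, eFa, eFb, eM, eX, eY, eXY]
  obtain ⟨hA0, hAmono, hAlsm⟩ := OrTailU.head_props (U := U) (a := a) pr hp hS t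
  exact orTailKSure_functional_nonneg U (fun W => prob pr (coreLevel arcs s U W))
    (fun X => prob pr (coreAvoidEvent arcs s t (insert a U) X)) pr ent c m₁ m₂ a w
    hp.nonneg hp.le_one hsure (fun W => prob_nonneg hp _)
    (fun s' hs' t' ht' => hν s' t' hs' ht') hA0 hAlsm hAmono

/-- **COROLLARY (out-tree core, any head, any number of sure entries).** `U` an out-tree core
(`TreeCore`), ANY set of sure entries of the tail (no condition on their ancestry), ANY two
markers, ANY head ⟹ row 2′DARC at `a → w`. -/
theorem darc_of_orTailTreeKSure (pr : E → R) (hp : IsProbVec pr) (hS : SameEnds arcs)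
    (h : OrTailK arcs s U ent c a) {c' : V → E} {par : V → V} {rk : V → ℕ}
    (hT : TreeCore arcs s U c' par rk) {m₁ m₂ : V} (hm₁ : m₁ ∈ U) (hm₂ : m₂ ∈ U)
    (hsure : ∀ r ∈ ent, pr (c r) = 1)
    {t : V} (htC : t ∉ insert a U) (hts : t ≠ s) (hws : w ≠ s) (hwC : w ∉ insert a U) :
    DARC pr arcs s {t} m₁ m₂ a w :=
  darc_of_orTailKSure pr hp hS h hm₁ hm₂ hsure (hT.coreLevel_lsm pr hp) htC hts hws hwC

end KSureMain

end Summit.Ventures.PercRepro2.Coin
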